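import Literature.NumberTheory.LFunctions.FordLemma32d0
import Literature.NumberTheory.LFunctions.FordVinogradovDiagonal
import Literature.NumberTheory.LFunctions.FordLemma68Rows
import HarnessLib

/-!
# Row chains for Ford's Table 6.1: iterating Lemmas 6.5 and 6.7 from the trivial bound

Topic `Literature/NumberTheory/LFunctions`. Everything here is PROVED; the definitions are the
bookkeeping of a chain (`Step`, `stepF`, `stepThr`, `chainC`, `chainΔ`, `StepOK`, `ChainOK`).

K. Ford, *Vinogradov's integral and bounds for the Riemann zeta function*, Proc. LMS 85 (2002),
proof of Lemma 6.8: a row `(k, n₀, n)` of Table 6.1 is certified by starting from the trivial bound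
`J_{n₀k,k}(P) ≤ k! P^{2n₀k - k(k+1)/2 + Δ}`, `Δ = k(k-1)/2` (`start_bound`), and iterating `n - n₀`
times a step `J_{s,k} ↦ J_{s+k,k}` taken from Lemma 6.7 (single prime in `[x, ηx]`, threshold `U`;
the tree's `FordVK.ford_lemma67`) or Lemma 6.5 (`k³` primes in `(x, ηx]`, threshold `V`;
`FordVK.ford_lemma65`, here in `k`-form `ford_lemma65'`), each multiplying the constant by
`max(T^Δ, F)` and the excess `Δ` by `1 - 1/k`. `chain_sound` is this iteration along an arbitrary
`List Step`, with the per-step numerical hypotheses collected in `ChainOK` and the two prime-window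
inputs as hypotheses (`hwinU`, `hwinV`; supplied unconditionally with `η = 23/20` by
`exists_prime_Icc_sylvester` and `Sylvester.card_primes_window_ge`). The numerical certification of
`ChainOK` and of the final constant of `FordVK.row_bound` for the individual rows is a separate
kernel computation.

## References

* K. Ford, Proc. London Math. Soc. (3) 85 (2002), 565–633; arXiv:1910.08209: Lemmas 6.5, 6.7 and
  the proof of Lemma 6.8 (Table 6.1). [Ford2002]
-/

noncomputable section

open Finset

namespace Literature.NumberTheory.LFunctions
namespace FordVK

open VMV

/-- A step of a row chain: `U u` = a single-prime step (Lemma 6.7, prime window `[x, ηx]` for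
`x ≥ u`), `V` = a `k³`-primes step (Lemma 6.5, threshold `V`). [cite: Ford2002, proof of Lemma 6.8] -/
inductive Step
  | U (u : ℕ)
  | V
  deriving DecidableEq, Repr

/-- The first-class constant of a step at `s` variables and excess `Δ`:
`8·2ᵏ·k!·C(k+s,k)²·η^{k²-Δ}` (Lemma 6.7 in the tree's constants) resp. `4k³k!η^{k²-Δ}` (Lemma 6.5).
[cite: Ford2002, Lemmas 6.5 and 6.7] -/
def stepF (k s : ℕ) (Δ η : ℝ) : Step → ℝ
  | .U _ => 8 * 2 ^ k * (Nat.factorial k) * (((k + s).choose k : ℕ) : ℝ) ^ 2 * η ^ ((k : ℝ) ^ 2 - Δ)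
  | .V => 4 * (k : ℝ) ^ 3 * (Nat.factorial k) * η ^ ((k : ℝ) ^ 2 - Δ)

/-- The threshold of a step (`U` resp. `V`). [cite: Ford2002, Lemmas 6.5 and 6.7] -/
def stepThr (V : ℝ) : Step → ℝ
  | .U u => u
  | .V => V

/-- The constant after a list of steps, starting from `C` at `n` blocks (`s = nk`) with excess `Δ`:
`C_{j+1} = C_j · max(T_j^{Δ_j}, F_j)`, `Δ_{j+1} = Δ_j (1 - 1/k)`. [cite: Ford2002, proof of Lemma 6.8] -/
def chainC (k : ℕ) (η V : ℝ) : ℕ → ℝ → ℝ → List Step → ℝ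
  | _, _, C, [] => C
  | n, Δ, C, st :: rest =>
      chainC k η V (n + 1) (Δ * (1 - 1 / k)) (C * max ((stepThr V st) ^ Δ) (stepF k (n * k) Δ η st)) rest

/-- The excess after a list of steps: `Δ (1 - 1/k)^{len}`. [cite: Ford2002, proof of Lemma 6.8] -/
def chainΔ (k : ℕ) (Δ : ℝ) (l : List Step) : ℝ := Δ * (1 - 1 / (k : ℝ)) ^ l.length

/-- The numerical side condition of a step at `n` blocks with excess `Δ` (the hypotheses of
Lemma 6.7 resp. 6.5 that depend on the step). [cite: Ford2002, Lemmas 6.5 and 6.7] -/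
def StepOK (k : ℕ) (V : ℝ) (n : ℕ) (Δ : ℝ) : Step → Prop
  | .U u => (k : ℝ) + 1 ≤ u ∧ (33 : ℝ) ≤ u ∧
      8 * (k : ℝ) ^ (2 * k + 2 * (n * k)) ≤ (u : ℝ) ^ ((2 * (n * k : ℕ) : ℝ) + 2 - k * (k + 1) / 2 + Δ * (1 - 1 / k)) ∧
      4 * ((2 * ((n * k : ℕ) + k) : ℝ) - k * (k + 1) / 2 + Δ * (1 - 1 / k)) ≤ (u : ℝ) ^ ((k : ℝ) - 1)
  | .V => 4 * ((2 * ((n * k : ℕ) + k) : ℝ) - k * (k + 1) / 2 + Δ * (1 - 1 / k)) ≤ V ^ (k - 1)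

/-- All side conditions along a chain. [cite: Ford2002, proof of Lemma 6.8] -/
def ChainOK (k : ℕ) (V : ℝ) : ℕ → ℝ → List Step → Prop
  | _, _, [] => True
  | n, Δ, st :: rest => StepOK k V n Δ st ∧ ChainOK k V (n + 1) (Δ * (1 - 1 / k)) rest

/-! ### The start of a chain: the trivial bound -/

/-- **The trivial start** (Ford: "`J_{nk,k}(P) ≤ P^{2nk-2k} J_{k,k}(P) ≤ k! P^{2nk-k(k+1)/2+Δ_n}`,
`Δ_n = ½k²(1-1/k)`"): for `n₀ ≥ 1` and `P ≥ 1`,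
`J_{n₀k,k}([1,P]) ≤ k! · P^{2n₀k - k(k+1)/2 + k(k-1)/2}`. [cite: Ford2002, proof of Lemma 6.8] -/
theorem start_bound {k n₀ : ℕ} (hn₀ : 1 ≤ n₀) (P : ℕ) (hP : 1 ≤ P) :
    (J k (n₀ * k) (Finset.Icc (1 : ℤ) P) : ℝ)
      ≤ (Nat.factorial k : ℝ) * (P : ℝ) ^ ((2 * (n₀ * k : ℕ) : ℝ) - k * (k + 1) / 2 + k * ((k : ℝ) - 1) / 2) := by
  have hP0 : (0 : ℝ) < P := by exact_mod_cast hP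
  have hsplit : n₀ * k = (n₀ - 1) * k + k := by
    obtain ⟨t, rfl⟩ : ∃ t, n₀ = t + 1 := ⟨n₀ - 1, by omega⟩
    simp [Nat.add_mul]
  have h1 := J_add_le k ((n₀ - 1) * k) k (Finset.Icc (1 : ℤ) P)
  have h2 := J_self_le k (Finset.Icc (1 : ℤ) P)
  rw [Int.card_Icc, show ((P : ℤ) + 1 - 1).toNat = P by simp] at h1 h2
  rw [← hsplit] at h1
  have h3 : (J k (n₀ * k) (Finset.Icc (1 : ℤ) P) : ℝ)
      ≤ (P : ℝ) ^ (2 * ((n₀ - 1) * k)) * ((Nat.factorial k : ℝ) * (P : ℝ) ^ k) := by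
    calc (J k (n₀ * k) (Finset.Icc (1 : ℤ) P) : ℝ) ≤ ((P ^ (2 * ((n₀ - 1) * k)) * J k k (Finset.Icc (1 : ℤ) P) : ℕ) : ℝ) := by
          exact_mod_cast h1
      _ ≤ ((P ^ (2 * ((n₀ - 1) * k)) * (Nat.factorial k * P ^ k) : ℕ) : ℝ) := by
          exact_mod_cast Nat.mul_le_mul_left _ h2
      _ = _ := by push_cast; ring
  refine h3.trans (le_of_eq ?_)
  rw [show (P : ℝ) ^ (2 * ((n₀ - 1) * k)) * ((Nat.factorial k : ℝ) * (P : ℝ) ^ k)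
      = (Nat.factorial k : ℝ) * ((P : ℝ) ^ (2 * ((n₀ - 1) * k)) * (P : ℝ) ^ k) by ring]
  congr 1
  rw [← pow_add, ← Real.rpow_natCast]
  congr 1
  have : 2 * ((n₀ - 1) * k) + k + k = 2 * (n₀ * k) := by rw [hsplit]; ring
  have h' : ((2 * ((n₀ - 1) * k) + k : ℕ) : ℝ) = 2 * (n₀ * k : ℕ) - k := by
    have := congrArg (fun x : ℕ => (x : ℝ)) this
    push_cast at this ⊢; linarith
  rw [h']; ring

/-! ### Lemma 6.5 in `k`-form -/

/-- `ford_lemma65` restated with the degree `k ≥ 2` (instead of `m + 2`). [cite: Ford2002, Lemma 6.5] -/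
theorem ford_lemma65' {k s : ℕ} (hk : 2 ≤ k) {C Δ η V : ℝ} (hs2 : (k : ℝ) * (k + 1) / 2 ≤ 2 * s)
    (hC0 : 0 ≤ C) (hΔ0 : 0 ≤ Δ) (hΔ : Δ ≤ (k : ℝ) ^ 2) (hη1 : 1 ≤ η) (hη2 : η ≤ 2)
    (hVk : (k : ℝ) + 1 ≤ V) (hV16 : 16 * (k : ℝ) ^ 4 ≤ V ^ k)
    (hV2 : 4 * ((2 * (s + k) : ℝ) - k * (k + 1) / 2 + Δ * (1 - 1 / k)) ≤ V ^ (k - 1))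
    (hprime : ∀ x : ℝ, V ≤ x → ∃ Ps : Finset ℕ, Ps.card = k ^ 3 ∧
      ∀ p ∈ Ps, p.Prime ∧ x < p ∧ (p : ℝ) ≤ η * x)
    (hJ : ∀ P : ℕ, 1 ≤ P →
      (J k s (Finset.Icc (1 : ℤ) P) : ℝ) ≤ C * (P : ℝ) ^ ((2 * s : ℝ) - k * (k + 1) / 2 + Δ)) :
    ∀ P : ℕ, 1 ≤ P → (J k (k + s) (Finset.Icc (1 : ℤ) P) : ℝ)
      ≤ C * max (V ^ Δ) (4 * (k : ℝ) ^ 3 * (Nat.factorial k) * η ^ ((k : ℝ) ^ 2 - Δ))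
          * (P : ℝ) ^ ((2 * (s + k) : ℝ) - k * (k + 1) / 2 + Δ * (1 - 1 / k)) := by
  obtain ⟨m, rfl⟩ : ∃ m, k = m + 2 := ⟨k - 2, by omega⟩
  have hcast : ((m + 2 : ℕ) : ℝ) = (m : ℝ) + 2 := by push_cast; ring
  have hV2' : 4 * ((2 * (s + (m + 2)) : ℝ) - (m + 2) * (m + 3) / 2 + Δ * (1 - 1 / (m + 2))) ≤ V ^ (m + 1) := by
    have e1 : m + 2 - 1 = m + 1 := by omega
    rw [e1, hcast] at hV2
    convert hV2 using 2; ring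
  have hs2' : ((m : ℝ) + 2) * ((m : ℝ) + 3) / 2 ≤ 2 * s := by
    rw [hcast] at hs2; convert hs2 using 1; ring
  have hJ' : ∀ P : ℕ, 1 ≤ P →
      (J (m + 2) s (Finset.Icc (1 : ℤ) P) : ℝ) ≤ C * (P : ℝ) ^ ((2 * s : ℝ) - (m + 2) * (m + 3) / 2 + Δ) := by
    intro P hP; have := hJ P hP; rw [hcast] at this; convert this using 3; ring
  have h := ford_lemma65 (m := m) (s := s) (C := C) (Δ := Δ) (η := η) (V := V)
    hs2' hC0 hΔ0 (by rwa [hcast] at hΔ) hη1 hη2 (by rw [hcast] at hVk; linarith) (by rwa [hcast] at hV16)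
    hV2' (by simpa using hprime) hJ'
  intro P hP
  have h' := h P hP
  rw [hcast]
  convert h' using 4; ring

/-! ### Soundness of a chain -/

/-- Auxiliary: `0 ≤ 1 - 1/k ≤ 1` for `k ≥ 1`. [folklore] -/
theorem one_sub_inv_mem {k : ℕ} (hk : 1 ≤ k) : 0 ≤ 1 - 1 / (k : ℝ) ∧ 1 - 1 / (k : ℝ) ≤ 1 := by
  have hk1 : (1 : ℝ) ≤ k := by exact_mod_cast hk
  constructor
  · rw [sub_nonneg, div_le_one (by linarith)]; exact hk1
  · have : 0 ≤ 1 / (k : ℝ) := by positivity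
    linarith

/-- **Soundness of a row chain.** Iterating Lemma 6.7 (`U`-steps, prime window `[x,ηx]` for
`x ≥ u`) and Lemma 6.5 (`V`-steps, `k³` primes in `(x, ηx]` for `x ≥ V`) along a list of steps whose
numerical side conditions hold (`ChainOK`): a bound `J_{nk,k}([1,P]) ≤ C P^{2nk-k(k+1)/2+Δ}` at the
start becomes `J_{(n+ℓ)k,k}([1,P]) ≤ C_ℓ P^{2(n+ℓ)k-k(k+1)/2+Δ(1-1/k)^ℓ}` with `C_ℓ = chainC …`.
[cite: Ford2002, proof of Lemma 6.8 ("we then proceed iteratively …")] -/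
theorem chain_sound {k : ℕ} (hk : 2 ≤ k) {η V : ℝ} (hη1 : 1 ≤ η) (hη2 : η ≤ 2)
    (hVk : (k : ℝ) + 1 ≤ V) (hV16 : 16 * (k : ℝ) ^ 4 ≤ V ^ k)
    (hwinU : ∀ u : ℕ, (33 : ℝ) ≤ u → ∀ x : ℝ, (u : ℝ) ≤ x → ∃ p : ℕ, p.Prime ∧ x ≤ p ∧ (p : ℝ) ≤ η * x)
    (hwinV : ∀ x : ℝ, V ≤ x → ∃ Ps : Finset ℕ, Ps.card = k ^ 3 ∧
      ∀ p ∈ Ps, p.Prime ∧ x < p ∧ (p : ℝ) ≤ η * x) :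
    ∀ (l : List Step) (n : ℕ) (Δ C : ℝ), (k : ℝ) * (k + 1) / 2 ≤ 2 * (n * k : ℕ) → 0 ≤ Δ →
      Δ ≤ (k : ℝ) ^ 2 → 0 ≤ C → ChainOK k V n Δ l →
      (∀ P : ℕ, 1 ≤ P → (J k (n * k) (Finset.Icc (1 : ℤ) P) : ℝ)
        ≤ C * (P : ℝ) ^ ((2 * (n * k : ℕ) : ℝ) - k * (k + 1) / 2 + Δ)) →
      ∀ P : ℕ, 1 ≤ P → (J k ((n + l.length) * k) (Finset.Icc (1 : ℤ) P) : ℝ)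
        ≤ chainC k η V n Δ C l * (P : ℝ) ^ ((2 * ((n + l.length) * k : ℕ) : ℝ) - k * (k + 1) / 2 + chainΔ k Δ l) := by
  have hk1 : 1 ≤ k := by omega
  have hq := one_sub_inv_mem hk1
  intro l
  induction l with
  | nil =>
    intro n Δ C _ _ _ _ _ hJ P hP
    simpa [chainC, chainΔ] using hJ P hP
  | cons st rest ih =>
    intro n Δ C hs2 hΔ0 hΔk hC0 hok hJ
    rw [ChainOK] at hok
    obtain ⟨hst, hrest⟩ := hok
    -- the new state
    set Δ' : ℝ := Δ * (1 - 1 / k) with hΔ'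
    set C' : ℝ := C * max ((stepThr V st) ^ Δ) (stepF k (n * k) Δ η st) with hC'
    have hΔ'0 : 0 ≤ Δ' := mul_nonneg hΔ0 hq.1
    have hΔ'k : Δ' ≤ (k : ℝ) ^ 2 := le_trans (mul_le_of_le_one_right hΔ0 hq.2) hΔk
    have hC'0 : 0 ≤ C' := by
      rw [hC']; refine mul_nonneg hC0 (le_trans ?_ (le_max_left _ _))
      cases st with
      | U u => exact Real.rpow_nonneg (Nat.cast_nonneg _) _
      | V => exact Real.rpow_nonneg (by simp only [stepThr]; linarith) _
    have hs2' : (k : ℝ) * (k + 1) / 2 ≤ 2 * ((n + 1) * k : ℕ) := by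
      refine hs2.trans ?_; push_cast; nlinarith
    -- the step
    have hstep : ∀ P : ℕ, 1 ≤ P → (J k ((n + 1) * k) (Finset.Icc (1 : ℤ) P) : ℝ)
        ≤ C' * (P : ℝ) ^ ((2 * ((n + 1) * k : ℕ) : ℝ) - k * (k + 1) / 2 + Δ') := by
      have hexp : ((2 * ((n + 1) * k : ℕ) : ℝ) - k * (k + 1) / 2 + Δ')
          = ((2 * ((n * k : ℕ) + k)) : ℝ) - k * (k + 1) / 2 + Δ * (1 - 1 / k) := by
        rw [hΔ']; push_cast; ring
      have hnk : (n + 1) * k = k + n * k := by ring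
      cases st with
      | U u =>
        obtain ⟨hu1, hu33, hU1, hU2⟩ := hst
        have h67 := ford_lemma67 (k := k) (s := n * k) (C := C) (Δ := Δ) (η := η) (U := (u : ℝ)) hk hs2
          hC0 hΔ0 hΔk hη1 hη2 hu1 hU1 hU2 (hwinU u hu33) hJ
        intro P hP
        rw [hexp, hnk]
        have := h67 P hP
        simpa [hC', stepThr, stepF] using this
      | V =>
        have h65 := ford_lemma65' (k := k) (s := n * k) hk (C := C) (Δ := Δ) (η := η) (V := V) hs2
          hC0 hΔ0 hΔk hη1 hη2 hVk hV16 hst hwinV hJ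
        intro P hP
        rw [hexp, hnk]
        have := h65 P hP
        simpa [hC', stepThr, stepF] using this
    -- iterate
    have hih := ih (n + 1) Δ' C' hs2' hΔ'0 hΔ'k hC'0 hrest hstep
    intro P hP
    have := hih P hP
    rw [show n + (st :: rest).length = n + 1 + rest.length by simp; ring]
    have eΔ : chainΔ k Δ (st :: rest) = chainΔ k Δ' rest := by
      simp only [chainΔ, List.length_cons, pow_succ', hΔ']; ring
    rw [eΔ]
    simpa [chainC, hC', hΔ'] using this

/-! ### From a certified chain to a row of Table 6.1 -/

/-- `((k(k+1)/2 : ℕ) : ℝ) = k(k+1)/2`. [folklore] -/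
theorem cast_mul_succ_div_two (k : ℕ) :
    ((k * (k + 1) / 2 : ℕ) : ℝ) = (k : ℝ) * ((k : ℝ) + 1) / 2 := by
  have h := Nat.two_mul_div_two_of_even (Nat.even_mul_succ_self k)
  have h' : ((2 * (k * (k + 1) / 2) : ℕ) : ℝ) = ((k * (k + 1) : ℕ) : ℝ) := by rw [h]
  push_cast at h'
  linarith

/-- **A row of Table 6.1 from a chain.** For `k ≥ 4`, `n₀ ≥ 1` with `k(k+1)/2 ≤ 2n₀k`, a list of
steps `l` with `ChainOK`, the prime-window inputs, and the exponent condition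
`1/(133.66(k-1)²) ≤ c = (1 - (2+2Δ)/(k+1))/(2nk)` at `n = n₀ + |l|`, `Δ = ½k(k-1)(1-1/k)^{|l|}`:
for `1 ≤ N < R ≤ 2N`, `0 < u ≤ 1`, `N^{k-1} ≤ t ≤ N^k`,
`‖∑_{N<n≤R}(n+u)^{-it}‖ ≤ C₀^{d₁/c} N^{1-(log N)²/(133.66 log² t)}` with
`C₀ = 4(k!(2πk)^k C)^{1/(2nk)} + 2`, `C = chainC … (k!) l`.
[cite: Ford2002, Lemma 6.8 and its proof (Table 6.1 rows)] -/
theorem row_of_chain {k n₀ : ℕ} (hk : 4 ≤ k) (hn₀ : 1 ≤ n₀)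
    (hn₀k : (k : ℝ) * (k + 1) / 2 ≤ 2 * (n₀ * k : ℕ)) {η V : ℝ} (hη1 : 1 ≤ η) (hη2 : η ≤ 2)
    (hVk : (k : ℝ) + 1 ≤ V) (hV16 : 16 * (k : ℝ) ^ 4 ≤ V ^ k)
    (hwinU : ∀ u : ℕ, (33 : ℝ) ≤ u → ∀ x : ℝ, (u : ℝ) ≤ x → ∃ p : ℕ, p.Prime ∧ x ≤ p ∧ (p : ℝ) ≤ η * x)
    (hwinV : ∀ x : ℝ, V ≤ x → ∃ Ps : Finset ℕ, Ps.card = k ^ 3 ∧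
      ∀ p ∈ Ps, p.Prime ∧ x < p ∧ (p : ℝ) ≤ η * x)
    (l : List Step) (hok : ChainOK k V n₀ ((k : ℝ) * ((k : ℝ) - 1) / 2) l)
    (hdc : 1 / (133.66 * ((k : ℝ) - 1) ^ 2)
      ≤ (1 - (2 + 2 * chainΔ k ((k : ℝ) * ((k : ℝ) - 1) / 2) l) / (k + 1)) / (2 * (((n₀ + l.length) * k : ℕ) : ℝ)))
    {N R : ℕ} {t u : ℝ} (hN : 1 ≤ N) (hNR : N < R) (hR : R ≤ 2 * N) (hu0 : 0 < u) (hu1 : u ≤ 1)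
    (ht1 : (N : ℝ) ^ (k - 1) ≤ t) (ht2 : t ≤ (N : ℝ) ^ k) :
    ‖∑ n ∈ Ioc N R, ((n : ℂ) + u) ^ (-(t * Complex.I))‖
      ≤ (4 * ((Nat.factorial k : ℝ) * (2 * Real.pi * k) ^ k
            * chainC k η V n₀ ((k : ℝ) * ((k : ℝ) - 1) / 2) (Nat.factorial k) l)
              ^ (1 / (2 * (((n₀ + l.length) * k : ℕ) : ℝ))) + 2)
          ^ ((1 / (133.66 * ((k : ℝ) - 1) ^ 2))
              / ((1 - (2 + 2 * chainΔ k ((k : ℝ) * ((k : ℝ) - 1) / 2) l) / (k + 1))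
                  / (2 * (((n₀ + l.length) * k : ℕ) : ℝ))))
        * (N : ℝ) ^ (1 - Real.log N ^ 2 / (133.66 * Real.log t ^ 2)) := by
  have hk2 : 2 ≤ k := le_trans (by norm_num) hk
  have hk1R : (1 : ℝ) ≤ k := by exact_mod_cast (le_trans (by norm_num) hk : 1 ≤ k)
  set Δ₀ : ℝ := (k : ℝ) * ((k : ℝ) - 1) / 2 with hΔ₀
  set n : ℕ := n₀ + l.length with hn
  set Cf : ℝ := chainC k η V n₀ Δ₀ (Nat.factorial k) l with hCf
  set Δf : ℝ := chainΔ k Δ₀ l with hΔf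
  have hΔ₀0 : 0 ≤ Δ₀ := by rw [hΔ₀]; nlinarith
  have hΔ₀k : Δ₀ ≤ (k : ℝ) ^ 2 := by rw [hΔ₀]; nlinarith
  have hq := one_sub_inv_mem (le_trans (by norm_num) hk : 1 ≤ k)
  have hΔf0 : 0 ≤ Δf := by rw [hΔf, chainΔ]; exact mul_nonneg hΔ₀0 (pow_nonneg hq.1 _)
  -- the start and the chain
  have hstart : ∀ P : ℕ, 1 ≤ P → (J k (n₀ * k) (Finset.Icc (1 : ℤ) P) : ℝ)
      ≤ (Nat.factorial k : ℝ) * (P : ℝ) ^ ((2 * (n₀ * k : ℕ) : ℝ) - k * (k + 1) / 2 + Δ₀) :=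
    fun P hP => start_bound hn₀ P hP
  have hchain := chain_sound hk2 hη1 hη2 hVk hV16 hwinU hwinV l n₀ Δ₀ (Nat.factorial k) hn₀k hΔ₀0 hΔ₀k
    (Nat.cast_nonneg _) hok hstart
  -- positivity of the constant: from the bound at `P = 1` (`J ≥ 1`)
  have hn1 : 1 ≤ n := le_trans hn₀ (Nat.le_add_right _ _)
  have hCf0 : 0 < Cf := by
    have h1 := hchain 1 le_rfl
    simp only [Nat.cast_one, Real.one_rpow, mul_one] at h1
    have h2 : (1 : ℝ) ≤ (J k ((n₀ + l.length) * k) (Finset.Icc (1 : ℤ) 1) : ℝ) := by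
      have := card_pow_le_J k ((n₀ + l.length) * k) (Finset.Icc (1 : ℤ) 1)
      simp at this
      exact_mod_cast this
    rw [hCf]; linarith
  -- the exponent in `row_bound`'s form
  have hexp : ∀ P : ℝ, 0 < P →
      P ^ ((2 * (n * k : ℕ) : ℝ) - k * (k + 1) / 2 + Δf)
        = P ^ ((2 * (n * k) : ℕ) - ((k * (k + 1) / 2 : ℕ) : ℝ) + Δf) := by
    intro P hP; congr 1; rw [cast_mul_succ_div_two]; push_cast; ring
  have he0 : 0 ≤ ((2 * (n * k : ℕ) : ℝ) - k * (k + 1) / 2 + Δf) := by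
    have : (k : ℝ) * (k + 1) / 2 ≤ 2 * (n * k : ℕ) := by
      refine hn₀k.trans ?_; rw [hn]; push_cast; nlinarith
    linarith
  -- `hJ` over real `P ≥ 1`
  have hJ : ∀ P : ℝ, 1 ≤ P → (J k (n * k) (Finset.Icc (1 : ℤ) ⌊P⌋₊) : ℝ)
      ≤ Cf * P ^ ((2 * (n * k) : ℕ) - ((k * (k + 1) / 2 : ℕ) : ℝ) + Δf) := by
    intro P hP
    have hP0 : 0 < P := by linarith
    have hfl1 : 1 ≤ ⌊P⌋₊ := Nat.le_floor (by simpa using hP)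
    have hflP : (⌊P⌋₊ : ℝ) ≤ P := Nat.floor_le hP0.le
    have h1 := hchain ⌊P⌋₊ hfl1
    rw [← hn] at h1
    rw [← hexp P hP0]
    refine h1.trans (mul_le_mul_of_nonneg_left ?_ hCf0.le)
    exact Real.rpow_le_rpow (Nat.cast_nonneg _) hflP he0
  exact row_bound hk hn1 hN hNR hR hu0 hu1 hCf0 hΔf0 ht1 ht2 hJ hdc

end FordVK
end Literature.NumberTheory.LFunctions
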